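import Summits.ResolutionOfSingularities.ResolutionOfSingularities.Theorems.HilbertSamuelEliminationCampaignW42TangentConeGenerators
import Literature.AlgebraicGeometry.Resolution.Ridge
import HarnessLib

/-!
# [OURS · L1 W4.2] Giraud's ridge does not depend on the generators of `𝔫`: transport of ridge points from an
# ARBITRARY generating family to a MINIMAL one (campaign s42, cell res-hironaka; informal crux `RidgeConfinement`,
# stmt-ResolutionOfSingularities-17845; `--supports`)

HONEST FRAMING. OURS (slot W4.2, prover res-L1-s42-pv-1, gen 3). Let `(A, 𝔫, k)` be a noetherian local ring, `x` a MINIMAL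
system of generators of `𝔫` (length `e = emb.dim`), `x'` ANY generating family (length `e'`), with transition matrices
`x = a·x'`, `x' = b·x`. The tangent cone ideals are related by `J_{x'} = Θ_b̄⁻¹(J_x)` for `Θ_b̄ : Z_l ↦ Σ_i b̄_{li} X_i`
(`…TangentConeGenerators.lean`). This file proves that a `κ`-point `w` of the ridge of `V(J_{x'}) ⊆ κ^{e'}` comes from a
`κ`-point `v` of the ridge of `V(J_x) ⊆ κ^e` under the dual linear map `λ : v ↦ (Σ_i b̄_{li} v_i)_l`:

* `rectSubst_comp`, `rectSubst_one` (composition = matrix product), `shift_rectSubst` (`λ`-equivariance of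
  translations: `shift_v ∘ Θ_B = Θ_B ∘ shift_{Bv}`), `rectSubst_coneIdeal_le` (`Θ_b̄` maps `J_{x'} ⊗ κ` into `J_x ⊗ κ`);
* `map_residue_mul_eq_one_of_minimal` — `ā·b̄ = 1` (`e × e`; minimality of `x`, Nakayama);
* `X_sub_sum_mem_tangentConeIdeal` — the linear forms `Z_l − Σ_{l'} (b a)‾_{l l'} Z_{l'}` lie in `J_{x'}`;
* **`exists_mem_ridge_of_mem_ridge_tangentConeIdeal`** — for `w ∈ ridge κ (J_{x'})` the vector
  `v_i = Σ_l ā_{il} w_l` lies in `ridge κ (J_x)` and `Σ_i b̄_{li} v_i = w_l` for all `l`.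

With `x = minGenerators A` this moves the fibre-cone confinement of `…PermissibleRidgeFibreCone.lean` (read in the
generators `(c, y)` of `𝔫`) to the route's `localRidge A`. NOTHING here is a statement of H. Hironaka's manuscript
[Hironaka2017]. AI review is weaker than expert review. References (orientation only): J. Giraud, Ann. Sci. ÉNS 8 (1975)
§1.5; V. Cossart, U. Jannsen, S. Saito, LNM 2270 (2020), Def. 2.18.
-/

noncomputable section

-- single-conjunct summit: the doubled namespace component `ResolutionOfSingularities` is mandated
set_option linter.dupNamespace false

open IsLocalRing MvPolynomial
open Literature.RingTheory.HilbertSamuel Literature.RingTheory.MvPolynomial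
open Literature.AlgebraicGeometry.Resolution

namespace Summit.ResolutionOfSingularities.ResolutionOfSingularities.Theorems

namespace CampaignW42

universe u

/-! ## Composition and translation-equivariance of linear substitutions -/

section Subst

variable {R : Type u} [CommRing R] {e e' e'' : ℕ}

/-- `Θ_b ∘ Θ_a = Θ_{ab}`: substituting `X_i ↦ Σ_l a_{il} Z_l` and then `Z_l ↦ Σ_j b_{lj} Y_j` is the substitution of
the product matrix. [folklore] -/
theorem rectSubst_comp (a : Matrix (Fin e) (Fin e') R) (b : Matrix (Fin e') (Fin e'') R) :
    (rectSubst b).comp (rectSubst a) = rectSubst (a * b) := by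
  refine MvPolynomial.algHom_ext fun i => ?_
  simp only [AlgHom.comp_apply, rectSubst_X, map_sum, map_mul, rectSubst_C, Matrix.mul_apply, Finset.sum_mul,
    Finset.mul_sum]
  rw [Finset.sum_comm]
  refine Finset.sum_congr rfl fun j _ => Finset.sum_congr rfl fun l _ => ?_
  ring

/-- `Θ_1 = id`. [folklore] -/
theorem rectSubst_one : rectSubst (1 : Matrix (Fin e) (Fin e) R) = AlgHom.id R _ := by
  refine MvPolynomial.algHom_ext fun i => ?_
  rw [rectSubst_X, AlgHom.id_apply, Finset.sum_eq_single i]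
  · rw [Matrix.one_apply_eq, C_1, one_mul]
  · intro j _ hji
    rw [Matrix.one_apply_ne (Ne.symm hji), C_0, zero_mul]
  · exact fun h => (h (Finset.mem_univ i)).elim

/-- `shift v (C r) = C r`. [folklore] -/
theorem shift_C' (v : Fin e → R) (r : R) : shift v (C r) = C r := by
  rw [shift, aeval_C, algebraMap_eq]

/-- **Translations and linear substitutions**: `shift_v (Θ_B g) = Θ_B (shift_{Bv} g)`, `(Bv)_l = Σ_i B_{li} v_i`.
[folklore] -/
theorem shift_rectSubst (B : Matrix (Fin e') (Fin e) R) (v : Fin e → R) (g : MvPolynomial (Fin e') R) :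
    shift v (rectSubst B g) = rectSubst B (shift (fun l => ∑ i, B l i * v i) g) := by
  rw [← AlgHom.comp_apply, ← AlgHom.comp_apply]
  congr 1
  refine MvPolynomial.algHom_ext fun l => ?_
  simp only [AlgHom.comp_apply, rectSubst_X, shift_X, map_add, map_sum, map_mul, rectSubst_C, shift_C', mul_add,
    Finset.sum_add_distrib]

end Subst

/-! ## Minimal versus arbitrary generators -/

section Minimal

variable {A : Type u} [CommRing A] [IsLocalRing A] [IsNoetherianRing A] {e e' : ℕ}
  {x : Fin e → A} {x' : Fin e' → A}
  (hx : Ideal.span (Set.range x) = maximalIdeal A) (he : (maximalIdeal A).spanFinrank = e)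
  (hx' : Ideal.span (Set.range x') = maximalIdeal A)
  {a : Matrix (Fin e) (Fin e') A} (ha : ∀ i, x i = ∑ l, a i l * x' l)
  {b : Matrix (Fin e') (Fin e) A} (hb : ∀ l, x' l = ∑ i, b l i * x i)

include hx he ha hb in
/-- **`ā·b̄ = 1`** for a MINIMAL system `x` and any generating family `x'` with `x = a·x'`, `x' = b·x`: the relation
`Σ_j ((ab)_{ij} − δ_{ij}) x_j = 0` has coefficients in `𝔫` (Nakayama). [folklore] -/
theorem map_residue_mul_eq_one_of_minimal : (a * b).map (residue A) = 1 := by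
  ext i j
  have h1 : ∑ j', (a * b) i j' * x j' = x i := by
    simp only [Matrix.mul_apply, Finset.sum_mul]
    rw [Finset.sum_comm, ha i]
    refine Finset.sum_congr rfl fun l _ => ?_
    rw [hb l, Finset.mul_sum]
    exact Finset.sum_congr rfl fun j' _ => by ring
  have h2 : ∑ j', (1 : Matrix (Fin e) (Fin e) A) i j' * x j' = x i := by
    rw [Finset.sum_eq_single i, Matrix.one_apply_eq, one_mul]
    · intro j' _ hj'
      rw [Matrix.one_apply_ne (Ne.symm hj'), zero_mul]
    · exact fun h => (h (Finset.mem_univ i)).elim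
  have hsum : ∑ j', ((a * b) i j' - (1 : Matrix (Fin e) (Fin e) A) i j') * x j' ∈ maximalIdeal A ^ 2 := by
    have : ∑ j', ((a * b) i j' - (1 : Matrix (Fin e) (Fin e) A) i j') * x j' = 0 := by
      simp only [sub_mul, Finset.sum_sub_distrib, h1, h2, sub_self]
    rw [this]
    exact zero_mem _
  have hcoeff := mem_maximalIdeal_of_sum_mul_mem_sq hx he hsum j
  rw [← residue_eq_zero_iff, map_sub, sub_eq_zero] at hcoeff
  rw [Matrix.map_apply, hcoeff, Matrix.one_apply, Matrix.one_apply]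
  split_ifs
  · exact map_one _
  · exact map_zero _

omit [IsNoetherianRing A] in
include hx' ha hb in
/-- **The linear forms `Z_l − Σ_{l'} (ba)‾_{l l'} Z_{l'}` lie in `J_{x'}`** (their lifts vanish at `x'`). [folklore] -/
theorem X_sub_sum_mem_tangentConeIdeal (l : Fin e') :
    X l - ∑ l', C (residue A ((b * a) l l')) * X l' ∈ tangentConeIdeal x' hx' := by
  refine mem_tangentConeIdeal_of_mem_symbolForms x' hx' 1 ((mem_symbolForms_iff_exists_form x' hx').mpr
    ⟨X l - ∑ l', C ((b * a) l l') * X l', ?_, ?_, ?_⟩)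
  · exact (isHomogeneous_X A l).sub (IsHomogeneous.sum _ _ _ fun l' _ => isHomogeneous_C_mul_X _ l')
  · have h0 : eval x' (X l - ∑ l', C ((b * a) l l') * X l') = 0 := by
      rw [map_sub, eval_X, map_sum]
      simp_rw [map_mul, eval_C, eval_X, Matrix.mul_apply, Finset.sum_mul]
      rw [Finset.sum_comm]
      simp_rw [mul_assoc, ← Finset.mul_sum, ← ha]
      rw [← hb l, sub_self]
    rw [h0]
    exact zero_mem _
  · simp [map_sum]

variable {κ : Type u} [CommRing κ] [Algebra (ResidueField A) κ]

omit [IsNoetherianRing A] in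
include hb in
/-- `Θ_b̄ ⊗ κ` maps `J_{x'} ⊗ κ` into `J_x ⊗ κ`. [folklore] -/
theorem rectSubst_mem_coneIdeal {f : MvPolynomial (Fin e') κ} (hf : f ∈ coneIdeal κ (tangentConeIdeal x' hx')) :
    rectSubst ((b.map (residue A)).map (algebraMap (ResidueField A) κ)) f ∈ coneIdeal κ (tangentConeIdeal x hx) := by
  have hle : coneIdeal κ (tangentConeIdeal x' hx') ≤ (coneIdeal κ (tangentConeIdeal x hx)).comap
      ((rectSubst ((b.map (residue A)).map (algebraMap (ResidueField A) κ)) :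
        MvPolynomial (Fin e') κ →ₐ[κ] MvPolynomial (Fin e) κ) : MvPolynomial (Fin e') κ →+* MvPolynomial (Fin e) κ) := by
    rw [coneIdeal, Ideal.map_le_iff_le_comap]
    intro g hg
    rw [Ideal.mem_comap, Ideal.mem_comap]
    change rectSubst ((b.map (residue A)).map (algebraMap (ResidueField A) κ))
      (MvPolynomial.map (algebraMap (ResidueField A) κ) g) ∈ _
    rw [← map_rectSubst]
    have hg' : rectSubst (b.map (residue A)) g ∈ tangentConeIdeal x hx := by
      have h := (tangentConeIdeal_eq_comap_rectSubst hx hx' hb).le hg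
      rwa [Ideal.mem_comap] at h
    exact map_mem_coneIdeal κ hg'
  exact hle hf

include hx he hx' ha hb in
/-- **Ridge points transport to a minimal system of generators.** For `w ∈ ridge κ (J_{x'})` (a `κ`-point of Giraud's
ridge of the tangent cone read in the generators `x'`), the vector `v_i = Σ_l ā_{il} w_l` is a `κ`-point of the ridge read
in the minimal generators `x`, and `Σ_i b̄_{li} v_i = w_l` for every `l`. [cite: Giraud1975, §1.5] -/
theorem exists_mem_ridge_of_mem_ridge_tangentConeIdeal {w : Fin e' → κ} (hw : w ∈ ridge κ (tangentConeIdeal x' hx')) :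
    ∃ v ∈ ridge κ (tangentConeIdeal x hx),
      ∀ l, ∑ i, algebraMap (ResidueField A) κ (residue A (b l i)) * v i = w l := by
  classical
  set ab : Matrix (Fin e) (Fin e') κ := (a.map (residue A)).map (algebraMap (ResidueField A) κ) with hab
  set bb : Matrix (Fin e') (Fin e) κ := (b.map (residue A)).map (algebraMap (ResidueField A) κ) with hbb
  set v : Fin e → κ := fun i => ∑ l, ab i l * w l with hv
  -- `λ v = w`: the forms `Z_l - Σ (ba)‾ Z` of `J_{x'}` vanish at `w`
  have hlam : ∀ l, ∑ i, bb l i * v i = w l := by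
    intro l
    have h0 := aeval_eq_zero_of_mem_ridge (tangentConeIdeal_le_ker_constantCoeff x' hx') hw
      (X_sub_sum_mem_tangentConeIdeal hx' ha hb l)
    rw [map_sub, aeval_X, map_sum, sub_eq_zero] at h0
    simp_rw [map_mul, aeval_C, aeval_X] at h0
    rw [h0]
    simp_rw [hv, Finset.mul_sum, hbb, hab, Matrix.map_apply, Matrix.mul_apply, map_sum, map_mul, Finset.sum_mul]
    rw [Finset.sum_comm]
    refine Finset.sum_congr rfl fun l' _ => Finset.sum_congr rfl fun i _ => ?_
    ring
  refine ⟨v, ?_, fun l => by simpa [hbb, Matrix.map_apply] using hlam l⟩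
  -- `v ∈ F(J_x)(κ)`: `h = Θ_b̄ (Θ_ā h)` with `Θ_ā h ∈ J_{x'}`, and `shift_v Θ_b̄ = Θ_b̄ shift_w`
  rw [mem_ridge_iff_forall_mem]
  intro h hh
  have hab1 : (a * b).map (residue A) = 1 := map_residue_mul_eq_one_of_minimal hx he ha hb
  have hΘΨ : rectSubst (b.map (residue A)) (rectSubst (a.map (residue A)) h) = h := by
    rw [← AlgHom.comp_apply, rectSubst_comp, ← Matrix.map_mul, hab1, rectSubst_one, AlgHom.id_apply]
  have hΨh : rectSubst (a.map (residue A)) h ∈ tangentConeIdeal x' hx' := by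
    rw [tangentConeIdeal_eq_comap_rectSubst hx hx' hb, Ideal.mem_comap]
    change rectSubst (b.map (residue A)) (rectSubst (a.map (residue A)) h) ∈ _
    rw [hΘΨ]; exact hh
  have hw' : shift w (MvPolynomial.map (algebraMap (ResidueField A) κ) (rectSubst (a.map (residue A)) h)) ∈
      coneIdeal κ (tangentConeIdeal x' hx') :=
    mem_ridge_iff_forall_mem.mp hw _ hΨh
  have hv' : (fun l => ∑ i, bb l i * v i) = w := _root_.funext hlam
  rw [← hΘΨ, map_rectSubst, shift_rectSubst, hv']
  exact rectSubst_mem_coneIdeal hx hx' hb hw'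

end Minimal

end CampaignW42

end Summit.ResolutionOfSingularities.ResolutionOfSingularities.Theorems

end
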